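import Mathlib
import Literature.NumberTheory.Sieve.Maynard2016LamSupport
import HarnessLib

/-!
# Maynard 2016: the moduli carried by a non-zero `λ_{d,e}` are small

Topic `Literature/NumberTheory/Sieve`. J. Maynard, *Large gaps between primes*, Ann. of Math. (2)
183 (2016), 915–933 = arXiv:1408.5110, §5 displays (5.3)–(5.4) and §6, proof of Lemma 7 before
(6.29): "`r = P_w[d, d', e, e', a] ≪ x^{1/5+o_k(1)}`, from the support conditions on `F_{ℓ,j}` and
`G`". By (5.4), `λ_{d,e} ≠ 0` forces `Σ_ℓ log d_ℓ / log x ≤ 1/10`, i.e. `∏_ℓ d_ℓ ≤ x^{1/10}`, and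
`e_ℓ ≤ y` for every `ℓ`, i.e. `∏_ℓ e_ℓ ≤ y^k`; hence `[d, d', e, e'] ≤ x^{1/5} y^{2k} = x^{1/5+o(1)}`.

PROVED here (no named facts): `sum_log_div_le_of_lam_ne_zero`, `prod_le_rpow_tenth_of_lam_ne_zero`
(`∏ d_ℓ ≤ x^{1/10}`), `le_y_of_lam_ne_zero` (`e_ℓ ≤ y`), `prod_le_pow_of_lam_ne_zero`
(`∏ e_ℓ ≤ y^k`).

## References

* J. Maynard, *Large gaps between primes*, Ann. of Math. (2) 183 (2016), 915–933; arXiv:1408.5110,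
  §5 (5.3)–(5.4) and Lemma 7 (proof, «r ≪ x^{1/5+o(1)}»). [Maynard2016LargeGaps]
-/

open Filter Finset
open scoped Topology

namespace Literature.NumberTheory.Sieve

namespace Maynard2016

/-- If `λ_{d,e} ≠ 0` then `Σ_ℓ log d_ℓ / log x ≤ 1/10` (support condition (5.4)). [cite: Maynard2016LargeGaps, §5 display (5.4)] -/
theorem sum_log_div_le_of_lam_ne_zero {k J : ℕ} {c : Fin J → ℝ} {Fd : Fin k → Fin J → ℝ → ℝ}
    {G : ℝ → ℝ} (hD : IsSieveData k J c Fd G) {ε : ℝ} {x : ℕ} (hlogx : 0 < Real.log x)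
    {d e : Fin k → ℕ} (hlam : lam c Fd G ε x d e ≠ 0) :
    ∑ ℓ, Real.log (d ℓ) / Real.log x ≤ 1 / 10 := by
  unfold lam at hlam
  have hS := right_ne_zero_of_mul hlam
  obtain ⟨j, -, hj⟩ := Finset.exists_ne_zero_of_sum_ne_zero hS
  have hP := right_ne_zero_of_mul hj
  have hall : ∀ ℓ, Fd ℓ j (Real.log (d ℓ) / Real.log x) ≠ 0 := fun ℓ =>
    left_ne_zero_of_mul (Finset.prod_ne_zero_iff.1 hP ℓ (Finset.mem_univ ℓ))
  have hu0 : ∀ ℓ, 0 ≤ Real.log (d ℓ) / Real.log x := fun ℓ =>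
    div_nonneg (Real.log_natCast_nonneg _) hlogx.le
  exact hD.Fd_support j (fun ℓ => Real.log (d ℓ) / Real.log x) hu0 hall

/-- **`∏_ℓ d_ℓ ≤ x^{1/10}`** whenever `λ_{d,e} ≠ 0` (and all `d_ℓ ≥ 1`, `log x > 0`). [cite: Maynard2016LargeGaps, Lemma 7 (proof, «r ≪ x^{1/5+o(1)} from the support conditions»)] -/
theorem prod_le_rpow_tenth_of_lam_ne_zero {k J : ℕ} {c : Fin J → ℝ}
    {Fd : Fin k → Fin J → ℝ → ℝ} {G : ℝ → ℝ} (hD : IsSieveData k J c Fd G) {ε : ℝ} {x : ℕ}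
    (hlogx : 0 < Real.log x) {d e : Fin k → ℕ} (hd : ∀ ℓ, 1 ≤ d ℓ)
    (hlam : lam c Fd G ε x d e ≠ 0) : (∏ ℓ, (d ℓ : ℝ)) ≤ (x : ℝ) ^ (1 / 10 : ℝ) := by
  have hsum := sum_log_div_le_of_lam_ne_zero hD hlogx hlam
  rw [← Finset.sum_div, div_le_iff₀ hlogx] at hsum
  have hx0 : (0 : ℝ) < x := by
    have hx1 : (x : ℝ) ≠ 0 := by
      intro h0; rw [h0, Real.log_zero] at hlogx; exact lt_irrefl _ hlogx
    exact lt_of_le_of_ne (Nat.cast_nonneg _) (Ne.symm hx1)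
  have hd0 : ∀ ℓ, (0 : ℝ) < d ℓ := fun ℓ => by exact_mod_cast hd ℓ
  have hP0 : 0 < ∏ ℓ, (d ℓ : ℝ) := Finset.prod_pos fun ℓ _ => hd0 ℓ
  have hlogP : Real.log (∏ ℓ, (d ℓ : ℝ)) = ∑ ℓ, Real.log (d ℓ) :=
    Real.log_prod fun ℓ _ => (hd0 ℓ).ne'
  rw [← Real.exp_log hP0, Real.rpow_def_of_pos hx0, hlogP]
  exact Real.exp_le_exp.2 (by linarith)

/-- If `λ_{d,e} ≠ 0` then every `e_ℓ ≤ y` (`G` is supported on `[0,1]`). [cite: Maynard2016LargeGaps, §5 display (5.3)] -/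
theorem le_y_of_lam_ne_zero {k J : ℕ} {c : Fin J → ℝ} {Fd : Fin k → Fin J → ℝ → ℝ}
    {G : ℝ → ℝ} (hD : IsSieveData k J c Fd G) {ε : ℝ} {x : ℕ} (hlogy : 0 < Real.log (y ε x))
    {d e : Fin k → ℕ} (hlam : lam c Fd G ε x d e ≠ 0) (ℓ : Fin k) : (e ℓ : ℝ) ≤ y ε x := by
  by_contra h
  exact hlam (lam_eq_zero_of_y_lt hD hlogy (lt_of_not_ge h))

/-- **`∏_ℓ e_ℓ ≤ y^k`** whenever `λ_{d,e} ≠ 0` (`log y > 0`). [cite: Maynard2016LargeGaps, Lemma 7 (proof, «r ≪ x^{1/5+o(1)} from the support conditions»)] -/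
theorem prod_le_pow_of_lam_ne_zero {k J : ℕ} {c : Fin J → ℝ} {Fd : Fin k → Fin J → ℝ → ℝ}
    {G : ℝ → ℝ} (hD : IsSieveData k J c Fd G) {ε : ℝ} {x : ℕ} (hlogy : 0 < Real.log (y ε x))
    {d e : Fin k → ℕ} (hlam : lam c Fd G ε x d e ≠ 0) : (∏ ℓ, (e ℓ : ℝ)) ≤ y ε x ^ k := by
  calc (∏ ℓ, (e ℓ : ℝ)) ≤ ∏ _ℓ : Fin k, y ε x :=
        Finset.prod_le_prod (fun ℓ _ => Nat.cast_nonneg _)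
          fun ℓ _ => le_y_of_lam_ne_zero hD hlogy hlam ℓ
    _ = y ε x ^ k := by simp

end Maynard2016

end Literature.NumberTheory.Sieve
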